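import Summits.ResolutionOfSingularities.ResolutionOfSingularities.Theorems.DeltaCutRunJunction
import Summits.ResolutionOfSingularities.ResolutionOfSingularities.Theorems.DeltaCutChainCertificates2
import HarnessLib

/-!
# DeltaCutRunCertificates — decomp-res node «RunCut» (lens-6 g25, critic row 190 CLEARED +1), tree file 5/7 of the node

Content VERBATIM from the decomp-res lens-6 g25 node `HOME/decomp-res-lens-6/g25/RunCut.lean` (pin e4e94516; NEW
part l. 1187–2651; the node's carry of g24 l. 89–1165 dropped in favour of `import …DeltaCutChain3` /
`…DeltaCutChainCertificates2`); HOME = run/shared/lean/pub/decomp-res; critic row 190 CLEARED +1; landing plan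
NEXT-g26.md bfe16773 §4 + rider INBOX :1047 — provenance, critic text and the lens header in full in the first file
of the node, `DeltaCutRun`.  Namespace `…Theorems.DeltaCutClasses`; `--supports stmt-ResolutionOfSingularities-26971`.

## This file

§RunCertificates — KERNEL CERTIFICATES of the run cut (node l. 1862–2651; polynomial level, char 3, `n = 3`,
LEVEL-INDEXED, format of g23/g24 `ChainCertificates`): DECIDED-NEW — D2 = `z³ + t·u³ + u⁴ + w⁴ + t⁷` has run height
EXACTLY 2 (`D2_runHeightTwo_certificate`: level 0 bad = {origin}; level 1 bad = {y₁ = chart-t origin}, wild with a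
near point; level 2: every order-3 point over `y₁` is TAME, bad = ∅ — so D2 is g24-RESIDUAL and g25-DECIDED: the cut
is STRICT); kind A — C_ax = `z³+t⁴+u⁴` at level 0 (`Cax_runInfiniteLevel_zero_certificate` = g24's
`Cax_curve_certificate` read with the level index) and B_S = `z³+t⁷+u⁷+w⁷` at level 1
(`BS_runInfiniteLevel_one_certificate`: on chart t the whole exceptional surface `z′ = t = 0` consists of bad
points); kind B (perpetual) — NO inhabitant claimed (ruling INBOX :1000 (vi)).  The ONE `set_option maxHeartbeats
400000 in` of the node (on `D2_runHeightTwo_certificate`) is kept.  (This first part carries: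
`three_eq_zero_mvPolynomial`, `one_not_mem_of_isPrime`, `mul_mem_pow_succ`, `add_mem_of_cube_add_cube_mem`,
`D2_isolated`, `D2_L1_chart_t_only`, `D2_L1_noTop_chart_z`, `D2_L1_noTop_chart_u`, `D2_L1_noTop_chart_w`,
`D2_L2_noTop_chart_X0`.)

[WRITER NOTE (decomp-res writer g12): file split only (tree files ≤ 400 lines); namespace, sections, section opens
and every declaration exactly as in the lens (the carry block and the node's global dupNamespace-linter line are
dropped — the library sets the latter; the two namespace-level `open …TwistCutClasses` / `open …LightCutClasses`
lines of the node are replayed).]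

(Sources: Hironaka1967 (characteristic polyhedra); CossartJannsenSaito2020 Def. 3.13 / Thm. 3.14, Ch. 8, Thm. 9.6;
Hironaka1970 (near points / vertices); CossartPiltant2019 Prop. 2.6; CossartPiltant2008 §2; Giraud1975; Hironaka2005
(three key theorems: order under permissible blow-up); König 1927 (Kőnig's lemma) as Mathlib
`nonempty_sections_of_finite_inverse_system`; EGAIV4 §16–§17; StacksProject 0804 / 0BIQ / 031I; Matsumura1987 §28.)
-/

noncomputable section

open CategoryTheory CategoryTheory.Limits AlgebraicGeometry TopologicalSpace IsLocalRing
open Literature.AlgebraicGeometry.Resolution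

universe u

namespace Summit.ResolutionOfSingularities.ResolutionOfSingularities.Theorems.DeltaCutClasses

open Summit.ResolutionOfSingularities.ResolutionOfSingularities.Theorems.TwistCutClasses
open Summit.ResolutionOfSingularities.ResolutionOfSingularities.Theorems.LightCutClasses

section RunCertificates

open MvPolynomial
variable {K : Type*} [Field K]

/-! ### §RunCertificates — KERNEL CERTIFICATES of the run cut (polynomial level, LEVEL-INDEXED; format of g23/g24
`ChainCertificates`)

Dictionary (as in the carried §ChainCertificates).  `K[z,t,u,w] = MvPolynomial (Fin 4) K`, `0 = z, 1 = t, 2 = u, 3 = w`, origin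
`𝔫₀ = (X₀,X₁,X₂,X₃)`, `n = 3`, `char K = 3`; «`ord_𝔮 g ≥ m`» at a prime `𝔮` is read `∃ s ∉ 𝔮, s·g ∈ 𝔮^m`; Rees chart `xᵢ` of the
blow-up of a closed point with parameters `x₀,…,x₃` has coordinates `xⱼ' = xⱼ/xᵢ (j ≠ i)`, `xᵢ` (the exceptional
parameter: the points
OVER the centre are the chart primes CONTAINING `xᵢ`), and `f = xᵢ³·f'`.  A LEVEL of the canonical bad run is certified by:
(bad ⊆) the classification of the primes of order `≥ 3` over the previous centre — chart by chart —, (wild) a `3`-POWER FORM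
`z'³ + (𝔮⁴)` at the bad prime (no absolute stalk contact, tree dictionary
`HugValuationCut.isAbsContactAt_iff_not_pPowerFormAt_closed`),
(near) the membership `f'' ∈ 𝔫''³` at a chart origin of the NEXT blow-up (the bad point HAS a near point: NOT
δ-light by (N)), and
(TAME) at a prime `𝔫` of order `3`: an absolute differential operator of order `2 = n − 1` extracts `∂∂f' = 2·e` with `e ∈ 𝔫` of
`𝔫`-order EXACTLY `1` (`∀ s' ∉ 𝔫, s'·e ∉ 𝔫²`: a REGULAR PARAMETER at `𝔫`) — absolute contact, the point is NOT bad.  Points of a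
level NOT over the previous centre are never bad (LEMMA A, `blowup_badCentre_base_mem`), so each level's bad locus
is read off the
charts over the previous bad points only.
* D2 = `z³ + t·u³ + u⁴ + w⁴ + t⁷` — THE DECIDED-NEW INHABITANT: RUN HEIGHT EXACTLY 2 (`D2_runHeightTwo_certificate`).
  LEVEL 0: Sing₃ = {origin} (`D2_isolated`: `∂_w f = 4w³`, `∂_u f = 4u³ + 3tu² = 4u³`, `∂_t f = u³ + 7t⁶`, `z³`), `3`-power form
  `z³ + (𝔫₀⁴)` (WILD), near point = the chart-`t` origin `y₁` (`f₁ = z'³ + t(u'³ + u'⁴ + w'⁴ + t³) ∈ 𝔫₁³`): bad₀ = {origin}.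
  LEVEL 1 (over the origin): charts `z`, `u`, `w` carry NO prime of order `3` on the exceptional divisor
(`D2_L1_noTop_chart_z/u/w`);
  in chart `t` every prime `𝔫 ∋ t` of order `3` contains `z', u', w'` (`D2_L1_chart_t_only`): the ONLY order-`3`
point over the origin is
  `y₁`; `y₁` is WILD (`f₁ = z'³ + (𝔫₁⁴)`) and HAS a near point, the chart-`w'` origin `y₂` of the blow-up at `y₁`
  (`f₂ = z''³ + t'w'(w' + u''³ + t'³ + u''⁴w') ∈ 𝔫₂³`): bad₁ = {y₁} — so D2 is g24-RESIDUAL (finite-chain kind: a wild δ-heavy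
  near-point chain of length 2) — and the run blows up `y₁`.
  LEVEL 2 (over `y₁`, coordinates of chart `t`: `0 = z', 1 = t, 2 = u', 3 = w'`): chart `z'`: no order-`3` prime
(`D2_L2_noTop_chart_X0`);
  chart `t`: every order-`3` prime `𝔫 ∋ t` contains `z''`, `1 + u''`, `e = u''⁴ + w''⁴` with `∂_t∂_t f₂ = 2e` and `e` a regular
  parameter at `𝔫` (`D2_L2_chart_X1`) — TAME; chart `u'`: every order-`3` prime `𝔫 ∋ u'` contains `z''`, `1 + t''`,
`1 + w''⁴`, with
  `∂_{u'}∂_{u'} f₂ = 2e`, `e = t''(1 + w''⁴)` a regular parameter at `𝔫` (`D2_L2_chart_X2`) — TAME; chart `w'`: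
every order-`3` prime
  `𝔫 ∋ w'` contains `z''`, `t'' + u''`, `e = t''(1 + u''⁴)` with `∂_{w'}∂_{w'} f₂ = 2e`, `e` a regular parameter at `𝔫`
  (`D2_L2_chart_X3`) — TAME (this chart contains `y₂`, its origin).  So EVERY order-`3` point of level 2 over `y₁`
is TAME: bad₂ = ∅,
  the run TERMINATES AT HEIGHT EXACTLY 2 and D2 ∈ `WORTopChainHeavyRunTame 3`'s data: g24-residual, g25-DECIDED (the
cut is STRICT).
* B_S = `z³ + t⁷ + u⁷ + w⁷` — KIND A AT LEVEL `i = 1` (`BS_runInfiniteLevel_one_certificate`): LEVEL 0: Sing₃ =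
{origin} (carried
  `BS_isolated`), wild, near point `y₁` = chart-`t` origin (carried `BS_chain_certificate`): bad₀ = {origin}, FINITE
— the run blows it
  up; LEVEL 1, chart `t` (`f₁ = z'³ + t⁴(1 + u'⁷ + w'⁷)`): `f₁ ∈ P³` for the prime `P = (z', t)` of the exceptional SURFACE
  `{z' = t = 0}` (`u', w' ∉ P`: a plane of closed points — INFINITELY many), `3`-power form `z'³ + (P⁴)` (WILD at
every closed point
  of the surface), and over EVERY closed point `c` of the surface the chart-`π` origin (`π` a local parameter of `c`
on the surface,
  read as `X₂`) is a near point: `z''³ + π·t''⁴·H ∈ 𝔫''³` for EVERY cofactor `H` — INFINITELY MANY bad points at level 1: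
  `RunInfiniteLevel` with `i = 1`, B_S ∈ `WORTopRunInfiniteLevel 3`'s data.
* C_ax = `z³ + t⁴ + u⁴` — KIND A AT LEVEL `i = 0` (`Cax_runInfiniteLevel_zero_certificate` = the carried
`Cax_curve_certificate` read
  with the level index: level 0 is the datum, the finite prefix is empty): infinitely many bad points downstairs (the `w`-axis).
* KIND B (perpetual: all levels finite nonempty, an infinite bad thread) — NO inhabitant is claimed or known (critic
ruling INBOX
  :1000 (vi)): see `bc/Probe.lean` (the kind is neither provable nor refutable from the cells; no collapse) and
NODE-g25.md §6. -/

/-- `3 = 0` in `K[z,t,u,w]`, `char K = 3`. [elementary] [folklore] -/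
theorem three_eq_zero_mvPolynomial [CharP K 3] : (3 : MvPolynomial (Fin 4) K) = 0 := by
  have h := CharP.cast_eq_zero (MvPolynomial (Fin 4) K) 3
  exact_mod_cast h

/-- `(1 : K[z,t,u,w]) ∉ 𝔫` for a prime `𝔫`. [elementary] [folklore] -/
theorem one_not_mem_of_isPrime (𝔫 : Ideal (MvPolynomial (Fin 4) K)) [h𝔫 : 𝔫.IsPrime] :
    (1 : MvPolynomial (Fin 4) K) ∉ 𝔫 := fun h1 => h𝔫.ne_top ((Ideal.eq_top_iff_one _).2 h1)

/-- `a ∈ I`, `b ∈ I^m` ⟹ `a·b ∈ I^(m+1)`. [elementary] [folklore] -/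
theorem mul_mem_pow_succ {A : Type*} [CommSemiring A] {I : Ideal A} {a b : A} {m : ℕ} (ha : a ∈ I) (hb : b ∈ I ^ m) :
    a * b ∈ I ^ (m + 1) := by
  rw [pow_succ']; exact Ideal.mul_mem_mul ha hb

/-- In characteristic `3`: `x³ + y³ = (x + y)³`, so a prime containing `x³ + y³` contains `x + y`. [elementary] [folklore] -/
theorem add_mem_of_cube_add_cube_mem [CharP K 3] (𝔫 : Ideal (MvPolynomial (Fin 4) K)) [h𝔫 : 𝔫.IsPrime]
    {x y : MvPolynomial (Fin 4) K} (h : x ^ 3 + y ^ 3 ∈ 𝔫) : x + y ∈ 𝔫 := by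
  refine h𝔫.mem_of_pow_mem 3 ?_
  have e : (x + y) ^ 3 = x ^ 3 + y ^ 3 + 3 * (x ^ 2 * y + x * y ^ 2) := by ring
  rw [e, three_eq_zero_mvPolynomial, zero_mul, add_zero]
  exact h

/-! #### D2 = `z³ + t·u³ + u⁴ + w⁴ + t⁷` — LEVEL 0 -/

/-- **D2, LEVEL 0 (I) — Sing₃(D2) = {origin}**: every prime `𝔮` with `ord_𝔮(z³ + tu³ + u⁴ + w⁴ + t⁷) ≥ 3` contains `z, t, u, w`
(`∂_w f = 4w³`; `∂_u f = 3tu² + 4u³ = 4u³` in characteristic `3`; `∂_t f = u³ + 7t⁶`; then `z³ ∈ 𝔮`). [new;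
elementary] [folklore] -/
theorem D2_isolated [CharP K 3] (𝔮 : Ideal (MvPolynomial (Fin 4) K)) [𝔮.IsPrime] {s : MvPolynomial (Fin 4) K}
    (hs : s ∉ 𝔮) (h : s * (X 0 ^ 3 + X 1 * X 2 ^ 3 + X 2 ^ 4 + X 3 ^ 4 + X 1 ^ 7 : MvPolynomial (Fin 4) K) ∈ 𝔮 ^ 3) :
    (X 0 : MvPolynomial (Fin 4) K) ∈ 𝔮 ∧ (X 1 : MvPolynomial (Fin 4) K) ∈ 𝔮 ∧
      (X 2 : MvPolynomial (Fin 4) K) ∈ 𝔮 ∧ (X 3 : MvPolynomial (Fin 4) K) ∈ 𝔮 := by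
  have hs2 : s ^ 2 ∉ 𝔮 := pow_not_mem 𝔮 hs 2
  have h4 : (4 : MvPolynomial (Fin 4) K) ∉ 𝔮 := by
    have := natCast_not_mem (K := K) 𝔮 (m := 4) (by decide)
    exact_mod_cast this
  have h7 : (7 : MvPolynomial (Fin 4) K) ∉ 𝔮 := by
    have := natCast_not_mem (K := K) 𝔮 (m := 7) (by decide)
    exact_mod_cast this
  have e10 := f_ne K (i := 1) (j := 0) (by decide)
  have e12 := f_ne K (i := 1) (j := 2) (by decide)
  have e13 := f_ne K (i := 1) (j := 3) (by decide)
  have e20 := f_ne K (i := 2) (j := 0) (by decide)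
  have e21 := f_ne K (i := 2) (j := 1) (by decide)
  have e23 := f_ne K (i := 2) (j := 3) (by decide)
  have e30 := f_ne K (i := 3) (j := 0) (by decide)
  have e31 := f_ne K (i := 3) (j := 1) (by decide)
  have e32 := f_ne K (i := 3) (j := 2) (by decide)
  have e11 := f_self K 1
  have e22 := f_self K 2
  have e33 := f_self K 3
  -- w
  have d3 : pderiv 3 (X 0 ^ 3 + X 1 * X 2 ^ 3 + X 2 ^ 4 + X 3 ^ 4 + X 1 ^ 7 : MvPolynomial (Fin 4) K) = 4 * X 3 ^ 3 := by
    simp only [map_add, Derivation.leibniz, Derivation.leibniz_pow, smul_eq_mul, nsmul_eq_mul, e30, e31, e32, e33]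
    push_cast; ring
  have hX3 : (X 3 : MvPolynomial (Fin 4) K) ∈ 𝔮 := by
    have := sq_mul_deriv_mem_pow 𝔮 h (pderiv 3)
    rw [d3] at this
    exact mem_of_mul_mul_pow_mem_pow 𝔮 two_ne_zero hs2 h4 this
  -- u
  have d2 : pderiv 2 (X 0 ^ 3 + X 1 * X 2 ^ 3 + X 2 ^ 4 + X 3 ^ 4 + X 1 ^ 7 : MvPolynomial (Fin 4) K) =
      3 * (X 1 * X 2 ^ 2) + 4 * X 2 ^ 3 := by
    simp only [map_add, Derivation.leibniz, Derivation.leibniz_pow, smul_eq_mul, nsmul_eq_mul, e20, e21, e22, e23]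
    push_cast; ring
  have hX2 : (X 2 : MvPolynomial (Fin 4) K) ∈ 𝔮 := by
    have := sq_mul_deriv_mem_pow 𝔮 h (pderiv 2)
    rw [d2, three_eq_zero_mvPolynomial, zero_mul, zero_add] at this
    exact mem_of_mul_mul_pow_mem_pow 𝔮 two_ne_zero hs2 h4 this
  -- t
  have d1 : pderiv 1 (X 0 ^ 3 + X 1 * X 2 ^ 3 + X 2 ^ 4 + X 3 ^ 4 + X 1 ^ 7 : MvPolynomial (Fin 4) K) =
      X 2 ^ 3 + 7 * X 1 ^ 6 := by
    simp only [map_add, Derivation.leibniz, Derivation.leibniz_pow, smul_eq_mul, nsmul_eq_mul, e10, e11, e12, e13]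
    push_cast; ring
  have hX1 : (X 1 : MvPolynomial (Fin 4) K) ∈ 𝔮 := by
    have h1 := sq_mul_deriv_mem_pow 𝔮 h (pderiv 1)
    rw [d1] at h1
    have h1' : s ^ 2 * (X 2 ^ 3 + 7 * X 1 ^ 6) ∈ 𝔮 := Ideal.pow_le_self two_ne_zero h1
    have h3 : s ^ 2 * (7 * X 1 ^ 6) ∈ 𝔮 ^ 1 := by
      rw [pow_one]
      have := Ideal.sub_mem _ h1' (Ideal.mul_mem_left _ (s ^ 2) (Ideal.pow_mem_of_mem 𝔮 hX2 3 (by norm_num)))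
      rwa [show s ^ 2 * (X 2 ^ 3 + 7 * X 1 ^ 6) - s ^ 2 * X 2 ^ 3 = s ^ 2 * (7 * X 1 ^ 6) by ring] at this
    exact mem_of_mul_mul_pow_mem_pow 𝔮 one_ne_zero hs2 h7 h3
  -- z
  have hf : (X 0 ^ 3 + X 1 * X 2 ^ 3 + X 2 ^ 4 + X 3 ^ 4 + X 1 ^ 7 : MvPolynomial (Fin 4) K) ∈ 𝔮 :=
    (‹𝔮.IsPrime›.mem_or_mem (Ideal.pow_le_self three_ne_zero h)).resolve_left hs
  have hX0 : (X 0 : MvPolynomial (Fin 4) K) ∈ 𝔮 := by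
    refine ‹𝔮.IsPrime›.mem_of_pow_mem 3 ?_
    have := Ideal.sub_mem _ hf (Ideal.add_mem _ (Ideal.add_mem _ (Ideal.add_mem _
      (Ideal.mul_mem_left _ (X 1) (Ideal.pow_mem_of_mem 𝔮 hX2 3 (by norm_num))) (Ideal.pow_mem_of_mem 𝔮 hX2 4 (by norm_num)))
      (Ideal.pow_mem_of_mem 𝔮 hX3 4 (by norm_num))) (Ideal.pow_mem_of_mem 𝔮 hX1 7 (by norm_num)))
    rwa [show (X 0 ^ 3 + X 1 * X 2 ^ 3 + X 2 ^ 4 + X 3 ^ 4 + X 1 ^ 7 - (X 1 * X 2 ^ 3 + X 2 ^ 4 + X 3 ^ 4 + X 1 ^ 7) :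
      MvPolynomial (Fin 4) K) = X 0 ^ 3 by ring] at this
  exact ⟨hX0, hX1, hX2, hX3⟩

/-! #### D2 — LEVEL 1 (charts of the blow-up of the origin) -/

/-- **D2, LEVEL 1, chart `t`** (`f₁ = z'³ + t(u'³ + u'⁴ + w'⁴ + t³)`, `0 = z', 1 = t, 2 = u', 3 = w'`): a prime `𝔫 ∋
t` of order `≥ 3`
contains `z', u', w'` — the ONLY order-`3` point on the exceptional divisor of the chart is its origin `y₁` (`∂_t f₁
= u'³ + u'⁴ + w'⁴ +
4t³`, then `∂_{w'}` of it `= 4w'³`, `∂_{u'}` of it `= 3u'² + 4u'³ = 4u'³`). [new; elementary] [folklore] -/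
theorem D2_L1_chart_t_only [CharP K 3] (𝔫 : Ideal (MvPolynomial (Fin 4) K)) [𝔫.IsPrime]
    (ht : (X 1 : MvPolynomial (Fin 4) K) ∈ 𝔫) {s : MvPolynomial (Fin 4) K} (hs : s ∉ 𝔫)
    (h : s * (X 0 ^ 3 + X 1 * (X 2 ^ 3 + X 2 ^ 4 + X 3 ^ 4 + X 1 ^ 3) : MvPolynomial (Fin 4) K) ∈ 𝔫 ^ 3) :
    (X 0 : MvPolynomial (Fin 4) K) ∈ 𝔫 ∧ (X 2 : MvPolynomial (Fin 4) K) ∈ 𝔫 ∧ (X 3 : MvPolynomial (Fin 4) K) ∈ 𝔫 := by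
  have hs2 : s ^ 2 ∉ 𝔫 := pow_not_mem 𝔫 hs 2
  have hs4 : (s ^ 2) ^ 2 ∉ 𝔫 := pow_not_mem 𝔫 hs2 2
  have h4 : (4 : MvPolynomial (Fin 4) K) ∉ 𝔫 := by
    have := natCast_not_mem (K := K) 𝔫 (m := 4) (by decide)
    exact_mod_cast this
  have e10 := f_ne K (i := 1) (j := 0) (by decide)
  have e12 := f_ne K (i := 1) (j := 2) (by decide)
  have e13 := f_ne K (i := 1) (j := 3) (by decide)
  have e21 := f_ne K (i := 2) (j := 1) (by decide)
  have e23 := f_ne K (i := 2) (j := 3) (by decide)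
  have e31 := f_ne K (i := 3) (j := 1) (by decide)
  have e32 := f_ne K (i := 3) (j := 2) (by decide)
  have e11 := f_self K 1
  have e22 := f_self K 2
  have e33 := f_self K 3
  have d1 : pderiv 1 (X 0 ^ 3 + X 1 * (X 2 ^ 3 + X 2 ^ 4 + X 3 ^ 4 + X 1 ^ 3) : MvPolynomial (Fin 4) K) =
      X 2 ^ 3 + X 2 ^ 4 + X 3 ^ 4 + 4 * X 1 ^ 3 := by
    simp only [map_add, Derivation.leibniz, Derivation.leibniz_pow, smul_eq_mul, nsmul_eq_mul, e10, e11, e12, e13]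
    push_cast; ring
  have d13 : pderiv 3 (X 2 ^ 3 + X 2 ^ 4 + X 3 ^ 4 + 4 * X 1 ^ 3 : MvPolynomial (Fin 4) K) = 4 * X 3 ^ 3 := by
    have e34 : pderiv 3 (4 : MvPolynomial (Fin 4) K) = 0 := by
      have := (pderiv 3 : Derivation K (MvPolynomial (Fin 4) K) _).map_natCast 4
      exact_mod_cast this
    simp only [map_add, Derivation.leibniz, Derivation.leibniz_pow, smul_eq_mul, nsmul_eq_mul, e31, e32, e33, e34]
    push_cast; ring
  have d12 : pderiv 2 (X 2 ^ 3 + X 2 ^ 4 + X 3 ^ 4 + 4 * X 1 ^ 3 : MvPolynomial (Fin 4) K) = 3 * X 2 ^ 2 + 4 * X 2 ^ 3 := by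
    have e24 : pderiv 2 (4 : MvPolynomial (Fin 4) K) = 0 := by
      have := (pderiv 2 : Derivation K (MvPolynomial (Fin 4) K) _).map_natCast 4
      exact_mod_cast this
    simp only [map_add, Derivation.leibniz, Derivation.leibniz_pow, smul_eq_mul, nsmul_eq_mul, e21, e22, e23, e24]
    push_cast; ring
  have h1 := sq_mul_deriv_mem_pow 𝔫 h (pderiv 1)
  rw [d1] at h1
  have hX3 : (X 3 : MvPolynomial (Fin 4) K) ∈ 𝔫 := by
    have h2 := sq_mul_deriv_mem_pow 𝔫 h1 (pderiv 3)
    rw [d13] at h2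
    exact mem_of_mul_mul_pow_mem_pow 𝔫 one_ne_zero hs4 h4 h2
  have hX2 : (X 2 : MvPolynomial (Fin 4) K) ∈ 𝔫 := by
    have h2 := sq_mul_deriv_mem_pow 𝔫 h1 (pderiv 2)
    rw [d12, three_eq_zero_mvPolynomial, zero_mul, zero_add] at h2
    exact mem_of_mul_mul_pow_mem_pow 𝔫 one_ne_zero hs4 h4 h2
  have hf : (X 0 ^ 3 + X 1 * (X 2 ^ 3 + X 2 ^ 4 + X 3 ^ 4 + X 1 ^ 3) : MvPolynomial (Fin 4) K) ∈ 𝔫 :=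
    (‹𝔫.IsPrime›.mem_or_mem (Ideal.pow_le_self three_ne_zero h)).resolve_left hs
  have hX0 : (X 0 : MvPolynomial (Fin 4) K) ∈ 𝔫 := by
    refine ‹𝔫.IsPrime›.mem_of_pow_mem 3 ?_
    have := Ideal.sub_mem _ hf (Ideal.mul_mem_right (X 2 ^ 3 + X 2 ^ 4 + X 3 ^ 4 + X 1 ^ 3) _ ht)
    rwa [show (X 0 ^ 3 + X 1 * (X 2 ^ 3 + X 2 ^ 4 + X 3 ^ 4 + X 1 ^ 3) - X 1 * (X 2 ^ 3 + X 2 ^ 4 + X 3 ^ 4 + X 1 ^ 3) :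
      MvPolynomial (Fin 4) K) = X 0 ^ 3 by ring] at this
  exact ⟨hX0, hX2, hX3⟩

/-- **D2, LEVEL 1, chart `z`** (`f₁ = 1 + z(t'u'³ + u'⁴ + w'⁴ + z³t'⁷)`, `0 = z, 1 = t', 2 = u', 3 = w'`): NO prime
`𝔫 ∋ z` has order
`≥ 3` (`f₁` is a unit along the exceptional divisor). [new; elementary] [folklore] -/
theorem D2_L1_noTop_chart_z (𝔫 : Ideal (MvPolynomial (Fin 4) K)) [𝔫.IsPrime]
    (hz : (X 0 : MvPolynomial (Fin 4) K) ∈ 𝔫) {s : MvPolynomial (Fin 4) K} (hs : s ∉ 𝔫) :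
    s * (1 + X 0 * (X 1 * X 2 ^ 3 + X 2 ^ 4 + X 3 ^ 4 + X 0 ^ 3 * X 1 ^ 7) : MvPolynomial (Fin 4) K) ∉ 𝔫 ^ 3 := by
  intro h
  have hf : (1 + X 0 * (X 1 * X 2 ^ 3 + X 2 ^ 4 + X 3 ^ 4 + X 0 ^ 3 * X 1 ^ 7) : MvPolynomial (Fin 4) K) ∈ 𝔫 :=
    (‹𝔫.IsPrime›.mem_or_mem (Ideal.pow_le_self three_ne_zero h)).resolve_left hs
  have h1mem : (1 : MvPolynomial (Fin 4) K) ∈ 𝔫 := by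
    have := Ideal.sub_mem _ hf (Ideal.mul_mem_right (X 1 * X 2 ^ 3 + X 2 ^ 4 + X 3 ^ 4 + X 0 ^ 3 * X 1 ^ 7) _ hz)
    rwa [add_sub_cancel_right] at this
  exact one_not_mem_of_isPrime 𝔫 h1mem

/-- **D2, LEVEL 1, chart `u`** (`f₁ = z'³ + u(1 + t' + w'⁴ + t'⁷u³)`, `0 = z', 1 = t', 2 = u, 3 = w'`): NO prime `𝔫
∋ u` has order
`≥ 3` (`∂_u f₁ = 1 + t' + w'⁴ + 4t'⁷u³`, `∂_{t'}` of it `= 1 + 28t'⁶u³`, so `1 ∈ 𝔫`). [new; elementary] [folklore] -/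
theorem D2_L1_noTop_chart_u [CharP K 3] (𝔫 : Ideal (MvPolynomial (Fin 4) K)) [𝔫.IsPrime]
    (hu : (X 2 : MvPolynomial (Fin 4) K) ∈ 𝔫) {s : MvPolynomial (Fin 4) K} (hs : s ∉ 𝔫) :
    s * (X 0 ^ 3 + X 2 * (1 + X 1 + X 3 ^ 4 + X 1 ^ 7 * X 2 ^ 3) : MvPolynomial (Fin 4) K) ∉ 𝔫 ^ 3 := by
  intro h
  have hs2 : s ^ 2 ∉ 𝔫 := pow_not_mem 𝔫 hs 2
  have hs4 : (s ^ 2) ^ 2 ∉ 𝔫 := pow_not_mem 𝔫 hs2 2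
  have e10 := f_ne K (i := 1) (j := 0) (by decide)
  have e12 := f_ne K (i := 1) (j := 2) (by decide)
  have e13 := f_ne K (i := 1) (j := 3) (by decide)
  have e20 := f_ne K (i := 2) (j := 0) (by decide)
  have e21 := f_ne K (i := 2) (j := 1) (by decide)
  have e23 := f_ne K (i := 2) (j := 3) (by decide)
  have e11 := f_self K 1
  have e22 := f_self K 2
  have d2 : pderiv 2 (X 0 ^ 3 + X 2 * (1 + X 1 + X 3 ^ 4 + X 1 ^ 7 * X 2 ^ 3) : MvPolynomial (Fin 4) K) =
      1 + X 1 + X 3 ^ 4 + 4 * (X 1 ^ 7 * X 2 ^ 3) := by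
    simp only [map_add, Derivation.leibniz, Derivation.leibniz_pow, smul_eq_mul, nsmul_eq_mul, e20, e21, e22, e23, f_one]
    push_cast; ring
  have d21 : pderiv 1 (1 + X 1 + X 3 ^ 4 + 4 * (X 1 ^ 7 * X 2 ^ 3) : MvPolynomial (Fin 4) K) =
      1 + 28 * (X 1 ^ 6 * X 2 ^ 3) := by
    have e14 : pderiv 1 (4 : MvPolynomial (Fin 4) K) = 0 := by
      have := (pderiv 1 : Derivation K (MvPolynomial (Fin 4) K) _).map_natCast 4
      exact_mod_cast this
    simp only [map_add, Derivation.leibniz, Derivation.leibniz_pow, smul_eq_mul, nsmul_eq_mul, e11, e12, e13, e14, f_one]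
    push_cast; ring
  have h1 := sq_mul_deriv_mem_pow 𝔫 h (pderiv 2)
  rw [d2] at h1
  have h2 := sq_mul_deriv_mem_pow 𝔫 h1 (pderiv 1)
  rw [d21, pow_one] at h2
  have hg : (1 + 28 * (X 1 ^ 6 * X 2 ^ 3) : MvPolynomial (Fin 4) K) ∈ 𝔫 := (‹𝔫.IsPrime›.mem_or_mem h2).resolve_left hs4
  have h1mem : (1 : MvPolynomial (Fin 4) K) ∈ 𝔫 := by
    have := Ideal.sub_mem _ hg (Ideal.mul_mem_left _ (28 * X 1 ^ 6) (Ideal.pow_mem_of_mem 𝔫 hu 3 (by norm_num)))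
    rwa [show (1 + 28 * (X 1 ^ 6 * X 2 ^ 3) - 28 * X 1 ^ 6 * X 2 ^ 3 : MvPolynomial (Fin 4) K) = 1 by ring] at this
  exact one_not_mem_of_isPrime 𝔫 h1mem

/-- **D2, LEVEL 1, chart `w`** (`f₁ = z'³ + w(1 + u'⁴ + t'u'³ + t'⁷w³)`, `0 = z', 1 = t', 2 = u', 3 = w`): NO prime
`𝔫 ∋ w` has order
`≥ 3` (`∂_w f₁ = 1 + u'⁴ + t'u'³ + 4t'⁷w³ ∈ 𝔫`; `∂_{t'}` of it `= u'³ + 28t'⁶w³` gives `u' ∈ 𝔫`, whence `1 ∈ 𝔫`).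
[new; elementary] [folklore] -/
theorem D2_L1_noTop_chart_w [CharP K 3] (𝔫 : Ideal (MvPolynomial (Fin 4) K)) [𝔫.IsPrime]
    (hw : (X 3 : MvPolynomial (Fin 4) K) ∈ 𝔫) {s : MvPolynomial (Fin 4) K} (hs : s ∉ 𝔫) :
    s * (X 0 ^ 3 + X 3 * (1 + X 2 ^ 4 + X 1 * X 2 ^ 3 + X 1 ^ 7 * X 3 ^ 3) : MvPolynomial (Fin 4) K) ∉ 𝔫 ^ 3 := by
  intro h
  have hs2 : s ^ 2 ∉ 𝔫 := pow_not_mem 𝔫 hs 2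
  have hs4 : (s ^ 2) ^ 2 ∉ 𝔫 := pow_not_mem 𝔫 hs2 2
  have e10 := f_ne K (i := 1) (j := 0) (by decide)
  have e12 := f_ne K (i := 1) (j := 2) (by decide)
  have e13 := f_ne K (i := 1) (j := 3) (by decide)
  have e30 := f_ne K (i := 3) (j := 0) (by decide)
  have e31 := f_ne K (i := 3) (j := 1) (by decide)
  have e32 := f_ne K (i := 3) (j := 2) (by decide)
  have e11 := f_self K 1
  have e33 := f_self K 3
  have d3 : pderiv 3 (X 0 ^ 3 + X 3 * (1 + X 2 ^ 4 + X 1 * X 2 ^ 3 + X 1 ^ 7 * X 3 ^ 3) : MvPolynomial (Fin 4) K) =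
      1 + X 2 ^ 4 + X 1 * X 2 ^ 3 + 4 * (X 1 ^ 7 * X 3 ^ 3) := by
    simp only [map_add, Derivation.leibniz, Derivation.leibniz_pow, smul_eq_mul, nsmul_eq_mul, e30, e31, e32, e33, f_one]
    push_cast; ring
  have d31 : pderiv 1 (1 + X 2 ^ 4 + X 1 * X 2 ^ 3 + 4 * (X 1 ^ 7 * X 3 ^ 3) : MvPolynomial (Fin 4) K) =
      X 2 ^ 3 + 28 * (X 1 ^ 6 * X 3 ^ 3) := by
    have e14 : pderiv 1 (4 : MvPolynomial (Fin 4) K) = 0 := by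
      have := (pderiv 1 : Derivation K (MvPolynomial (Fin 4) K) _).map_natCast 4
      exact_mod_cast this
    simp only [map_add, Derivation.leibniz, Derivation.leibniz_pow, smul_eq_mul, nsmul_eq_mul, e11, e12, e13, e14, f_one]
    push_cast; ring
  have h1 := sq_mul_deriv_mem_pow 𝔫 h (pderiv 3)
  rw [d3] at h1
  have hg : (1 + X 2 ^ 4 + X 1 * X 2 ^ 3 + 4 * (X 1 ^ 7 * X 3 ^ 3) : MvPolynomial (Fin 4) K) ∈ 𝔫 :=
    (‹𝔫.IsPrime›.mem_or_mem (Ideal.pow_le_self two_ne_zero h1)).resolve_left hs2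
  have h2 := sq_mul_deriv_mem_pow 𝔫 h1 (pderiv 1)
  rw [d31, pow_one] at h2
  have hg' : (X 2 ^ 3 + 28 * (X 1 ^ 6 * X 3 ^ 3) : MvPolynomial (Fin 4) K) ∈ 𝔫 :=
    (‹𝔫.IsPrime›.mem_or_mem h2).resolve_left hs4
  have hX2 : (X 2 : MvPolynomial (Fin 4) K) ∈ 𝔫 := by
    refine ‹𝔫.IsPrime›.mem_of_pow_mem 3 ?_
    have := Ideal.sub_mem _ hg' (Ideal.mul_mem_left _ (28 * X 1 ^ 6) (Ideal.pow_mem_of_mem 𝔫 hw 3 (by norm_num)))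
    rwa [show (X 2 ^ 3 + 28 * (X 1 ^ 6 * X 3 ^ 3) - 28 * X 1 ^ 6 * X 3 ^ 3 : MvPolynomial (Fin 4) K) = X 2 ^ 3 by ring] at this
  have h1mem : (1 : MvPolynomial (Fin 4) K) ∈ 𝔫 := by
    have := Ideal.sub_mem _ hg (Ideal.add_mem _ (Ideal.add_mem _ (Ideal.pow_mem_of_mem 𝔫 hX2 4 (by norm_num))
      (Ideal.mul_mem_left _ (X 1) (Ideal.pow_mem_of_mem 𝔫 hX2 3 (by norm_num))))
      (Ideal.mul_mem_left _ (4 * X 1 ^ 7) (Ideal.pow_mem_of_mem 𝔫 hw 3 (by norm_num))))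
    rwa [show (1 + X 2 ^ 4 + X 1 * X 2 ^ 3 + 4 * (X 1 ^ 7 * X 3 ^ 3) - (X 2 ^ 4 + X 1 * X 2 ^ 3 + 4 * X 1 ^ 7 * X 3 ^ 3) :
      MvPolynomial (Fin 4) K) = 1 by ring] at this
  exact one_not_mem_of_isPrime 𝔫 h1mem

/-! #### D2 — LEVEL 2 (charts of the blow-up at `y₁`; coordinates of chart `t`: `0 = z', 1 = t, 2 = u', 3 = w'`) -/

/-- **D2, LEVEL 2, chart `z'`** (`f₂ = 1 + z'(…)`): NO prime `𝔫 ∋ z'` has order `≥ 3`. [new; elementary] [folklore] -/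
theorem D2_L2_noTop_chart_X0 (𝔫 : Ideal (MvPolynomial (Fin 4) K)) [𝔫.IsPrime]
    (hz : (X 0 : MvPolynomial (Fin 4) K) ∈ 𝔫) {s : MvPolynomial (Fin 4) K} (hs : s ∉ 𝔫) :
    s * (1 + X 0 * (X 1 * X 2 ^ 3 + X 1 ^ 4 + X 0 * X 1 * X 3 ^ 4 + X 0 * X 1 * X 2 ^ 4) : MvPolynomial (Fin 4) K) ∉ 𝔫 ^ 3 := by
  intro h
  have hf : (1 + X 0 * (X 1 * X 2 ^ 3 + X 1 ^ 4 + X 0 * X 1 * X 3 ^ 4 + X 0 * X 1 * X 2 ^ 4) : MvPolynomial (Fin 4) K) ∈ 𝔫 :=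
    (‹𝔫.IsPrime›.mem_or_mem (Ideal.pow_le_self three_ne_zero h)).resolve_left hs
  have h1mem : (1 : MvPolynomial (Fin 4) K) ∈ 𝔫 := by
    have := Ideal.sub_mem _ hf (Ideal.mul_mem_right (X 1 * X 2 ^ 3 + X 1 ^ 4 + X 0 * X 1 * X 3 ^ 4 + X 0 * X 1 * X 2 ^ 4) _ hz)
    rwa [add_sub_cancel_right] at this
  exact one_not_mem_of_isPrime 𝔫 h1mem

end RunCertificates

end Summit.ResolutionOfSingularities.ResolutionOfSingularities.Theorems.DeltaCutClasses
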